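import Summits.QuantumFields.YangMills.Theorems.CovariantDischargeMatchedChargeKernelBounds
import Summits.QuantumFields.YangMills.Theorems.CovariantDischargeFreeGreenKernelBoxBounds
import HarnessLib

/-!
# Line «sandwich_discharge» on crux `HistoryTailL` (stmt-QuantumFields-19936), stub `stub_sandwichSweepGapCapped` (S′), brick B5 on `ℤ³` —
# (Z-e) FILE 3 «THE GREEN POTENTIAL ON ℤ³: THE SHELL, THE BULK MASS AND THE NEAR ℓ¹ MASS PRICED BY THE FREE KERNEL'S CONSTANTS»

Cell `ym3-torus` (YM ladder rung R3 = continuum SU(2) Yang–Mills on the three-torus — a RUNG, NOT the Clay problem: not d = 4, not infinite volume,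
not a mass gap); width seat `ym3-torus-px8` gen 7; `--supports stmt-QuantumFields-19936` (helper).  THEOREMS ONLY (0 `def`, default heartbeats), `d = 3`,
in the letters of FILE 1 `CovariantDischargeTruncatedPotentialPairing` ∕ FILE 2 `CovariantDischargeGreenPotentialL2` (free symbols pinned by pointwise
hypotheses) over ✓p713769 (Z-c) `CovariantDischargeMatchedChargeKernelBounds` (w8 g8); the kernel hypotheses are ✓p714724 (Z-c′)'s (H1)(H2) shapes.

THE OBJECTS.  `ω` a real 2-form on `ℤ³` vanishing off `box p ℓ` with EVERY COMPONENT MEAN ZERO (`Σ_y ω(y,μ,ν) = 0` — px8 g6's dipole∕monopole matching);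
`β := (G∕2) ∗ ω` componentwise (`G = latticeGreen`), `a := δ₂β`, `γ := d₂β`; the free kernel's first differences `K_e(w) := G(w + e_e) − G(w)` with the
box-language decay constants `C₁` ((H1): `|K_e w| ≤ C₁∕n²` off `box 0 (n−1)`) and `C₂` ((H2): `|K_e(w+e_i) − K_e w| ≤ C₂∕n³`) of (Z-c′) as HYPOTHESES
(discharged in FILE 4 by ✓`exists_fdiff_latticeGreen_box_bounds`).  Masses: `M₀ := Σ_{μν} Σ_y |ω(y,μ,ν)|`, `M₁ := Σ_{μν} Σ_y ‖y − p‖₁·|ω(y,μ,ν)|`.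
* §1 `potential_eq_conv` ∕ `grad_potential_eq_conv` ∕ `dTwo_eq_conv`: `a(x,ν) = −½ Σ_μ (K_μ ∗ ω_{μν})(x − e_μ)`, `∇_aβ_c(x) = ½ (K_a ∗ ω_c)(x)`,
  `γ(x,κ,μ,ν) = ½[(K_κ ∗ ω_{μν}) − (K_μ ∗ ω_{κν}) + (K_ν ∗ ω_{κμ})](x)`.
* §2 FAR FIELD (✓`abs_sum_mul_le_of_decay` by name, `q = 3`): off `box p N` (`N ≥ 2ℓ + 2`), `|a(x,ν)| ≤ 12·C₂·M₁∕N³` and `|γ(x,κ,μ,ν)| ≤ 12·C₂·M₁∕N³`.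
* §3 ★★ `shell_le`: FILE 1's `SHELL = Σ_{box p (S+1) ∖ box p (R−1)} Σ_{μν}(|a(y+e_μ,ν)| + |a(y+e_ν,μ)| + Σ_κ|γ(y−e_κ,κ,μ,ν)|) ≤ 540·#box p (S+1)·C₂·M₁∕(R−2)³`
  (`2ℓ + 4 ≤ R`); ★★ `shell_le_of_twelve_le`: with `S = 2R`, `R ≥ 12`: `SHELL ≤ 72000·C₂·M₁` — so FILE 1's commutator error is `≤ θ·72000·C₂·M₁∕R`.
* §4 ★ `bulk_mass_le`: `Σ_{box p S} Σ_{κμν}|γ| ≤ (81∕2)·(Σ_e|K_e 0| + 26·C₁·(S + ℓ))·M₀`; ★ `near_mass_le`: `Σ_{box p S} Σ_ν |a| ≤ (9∕2)·(Σ_e|K_e 0| + 26·C₁·(S+1+ℓ))·M₀`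
  (✓`sum_box_abs_sum_mul_le` by name).
(The (H1)(H2) hypotheses are discharged by ✓`exists_fdiff_latticeGreen_box_bounds` in the assembly file, once, for all three rows.)
Text-independent of the stub; restates no stub.  HONEST SCOPE: finite sums over two landed files by name; NOTHING here proves B5, the capped stub, `HistoryTailL`,
or any summit statement; YM₃ on T³ is rung R3, not Clay. [folklore] (kernel bounds: Lawler 1991 Thm 1.5.5 — lit, cited in (Z-c′)).
-/

noncomputable section

open scoped BigOperators
open Finset

namespace Summit.QuantumFields.YangMills.Theorems.CovariantDischargeGreenPotentialShell

open Literature.Probability.LatticeModels (latticeGreen)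
open Literature.MathematicalPhysics.QuantumFieldTheory.Balaban1983to89.B4Eq19LatticeOperators
open Summit.QuantumFields.YangMills.Theorems.CovariantDischargeMatchedChargeKernelBounds (abs_sum_mul_le_of_decay sum_box_abs_sum_mul_le)

/-! ## §1 The potential and its cube derivative as first-difference convolutions -/

/-- `a(x,ν) = −½·Σ_μ Σ_y K_μ((x − e_μ) − y)·ω(y,μ,ν)`, `K_μ(w) = G(w + e_μ) − G(w)`. [folklore] -/
theorem potential_eq_conv (ω β : Zd 3 → Fin 3 → Fin 3 → ℝ) (a : Zd 3 → Fin 3 → ℝ) (p : Zd 3) (ℓ : ℕ)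
    (hβ : ∀ x μ ν, β x μ ν = ∑ y ∈ box p ℓ, latticeGreen (x - y) / 2 * ω y μ ν)
    (ha : ∀ x ν, a x ν = ∑ μ, (β (x - unitVec μ) μ ν - β x μ ν)) (x : Zd 3) (ν : Fin 3) :
    a x ν = -(1 / 2) * ∑ μ, ∑ y ∈ box p ℓ, (latticeGreen ((x - unitVec μ) - y + unitVec μ) - latticeGreen ((x - unitVec μ) - y)) * ω y μ ν := by
  rw [ha, Finset.mul_sum]
  refine Finset.sum_congr rfl fun μ _ => ?_
  rw [hβ, hβ, ← Finset.sum_sub_distrib, Finset.mul_sum]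
  refine Finset.sum_congr rfl fun y _ => ?_
  rw [show x - unitVec μ - y + unitVec μ = x - y by abel]
  ring

/-- `∇_aβ_c(x) = ½·Σ_y K_a(x − y)·ω_c(y)`. [folklore] -/
theorem grad_potential_eq_conv (ω β : Zd 3 → Fin 3 → Fin 3 → ℝ) (p : Zd 3) (ℓ : ℕ)
    (hβ : ∀ x μ ν, β x μ ν = ∑ y ∈ box p ℓ, latticeGreen (x - y) / 2 * ω y μ ν) (x : Zd 3) (e c₁ c₂ : Fin 3) :
    β (x + unitVec e) c₁ c₂ - β x c₁ c₂ = (1 / 2) * ∑ y ∈ box p ℓ, (latticeGreen (x - y + unitVec e) - latticeGreen (x - y)) * ω y c₁ c₂ := by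
  rw [hβ, hβ, ← Finset.sum_sub_distrib, Finset.mul_sum]
  refine Finset.sum_congr rfl fun y _ => ?_
  rw [show x + unitVec e - y = x - y + unitVec e by abel]
  ring

/-- `γ(x,κ,μ,ν) = ½[(K_κ ∗ ω_{μν})(x) − (K_μ ∗ ω_{κν})(x) + (K_ν ∗ ω_{κμ})(x)]`. [folklore] -/
theorem dTwo_eq_conv (ω β : Zd 3 → Fin 3 → Fin 3 → ℝ) (γ : Zd 3 → Fin 3 → Fin 3 → Fin 3 → ℝ) (p : Zd 3) (ℓ : ℕ)
    (hβ : ∀ x μ ν, β x μ ν = ∑ y ∈ box p ℓ, latticeGreen (x - y) / 2 * ω y μ ν)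
    (hγ : ∀ x κ μ ν, γ x κ μ ν = (β (x + unitVec κ) μ ν - β x μ ν) - (β (x + unitVec μ) κ ν - β x κ ν) + (β (x + unitVec ν) κ μ - β x κ μ))
    (x : Zd 3) (κ μ ν : Fin 3) :
    γ x κ μ ν = (1 / 2) * ∑ y ∈ box p ℓ, (latticeGreen (x - y + unitVec κ) - latticeGreen (x - y)) * ω y μ ν
      - (1 / 2) * ∑ y ∈ box p ℓ, (latticeGreen (x - y + unitVec μ) - latticeGreen (x - y)) * ω y κ ν
      + (1 / 2) * ∑ y ∈ box p ℓ, (latticeGreen (x - y + unitVec ν) - latticeGreen (x - y)) * ω y κ μ := by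
  rw [hγ, grad_potential_eq_conv ω β p ℓ hβ, grad_potential_eq_conv ω β p ℓ hβ, grad_potential_eq_conv ω β p ℓ hβ]

/-! ## §2 The far field of `a` and `γ` -/

/-- One component of the first moment is at most the total first moment. [folklore] -/
theorem firstMoment_le_total (ω : Zd 3 → Fin 3 → Fin 3 → ℝ) (p : Zd 3) (ℓ : ℕ) (c₁ c₂ : Fin 3) :
    ∑ y ∈ box p ℓ, (∑ i, |((y i - p i : ℤ) : ℝ)|) * |ω y c₁ c₂|
      ≤ ∑ μ, ∑ ν, ∑ y ∈ box p ℓ, (∑ i, |((y i - p i : ℤ) : ℝ)|) * |ω y μ ν| := by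
  have h1 : ∑ y ∈ box p ℓ, (∑ i, |((y i - p i : ℤ) : ℝ)|) * |ω y c₁ c₂|
      ≤ ∑ ν, ∑ y ∈ box p ℓ, (∑ i, |((y i - p i : ℤ) : ℝ)|) * |ω y c₁ ν| :=
    Finset.single_le_sum (f := fun ν => ∑ y ∈ box p ℓ, (∑ i, |((y i - p i : ℤ) : ℝ)|) * |ω y c₁ ν|)
      (fun ν _ => Finset.sum_nonneg fun y _ => by positivity) (Finset.mem_univ c₂)
  refine h1.trans ?_
  exact Finset.single_le_sum (f := fun μ => ∑ ν, ∑ y ∈ box p ℓ, (∑ i, |((y i - p i : ℤ) : ℝ)|) * |ω y μ ν|)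
    (fun μ _ => Finset.sum_nonneg fun ν _ => Finset.sum_nonneg fun y _ => by positivity) (Finset.mem_univ c₁)

/-- ★ **THE FAR FIELD OF ONE FIRST-DIFFERENCE CONVOLUTION** ((Z-c) by name): off `box p (N−1)`, `N ≥ 2ℓ+2`, under (H2) and `Σ_y ω_c(y) = 0`,
`|Σ_y K_e(x − y)·ω_c(y)| ≤ (8·C₂∕N³)·M₁`. [folklore] -/
theorem abs_conv_le_far {C₂ : ℝ} (hC₂ : 0 ≤ C₂)
    (hK2 : ∀ (e : Fin 3) (w : Zd 3) (n : ℕ), 2 ≤ n → w ∉ box (0 : Zd 3) ((n : ℤ) - 1) → ∀ i : Fin 3,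
      |(latticeGreen (w + unitVec i + unitVec e) - latticeGreen (w + unitVec i)) - (latticeGreen (w + unitVec e) - latticeGreen w)| ≤ C₂ / (n : ℝ) ^ 3)
    (ω : Zd 3 → Fin 3 → Fin 3 → ℝ) (p : Zd 3) (ℓ : ℕ) (hω1 : ∀ μ ν, ∑ y ∈ box p ℓ, ω y μ ν = 0)
    (e c₁ c₂ : Fin 3) (x : Zd 3) (N : ℕ) (hN : 2 * ℓ + 2 ≤ N) (hx : x ∉ box p ((N : ℤ) - 1)) :
    |∑ y ∈ box p ℓ, (latticeGreen (x - y + unitVec e) - latticeGreen (x - y)) * ω y c₁ c₂|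
      ≤ (8 * C₂ / (N : ℝ) ^ 3) * ∑ μ, ∑ ν, ∑ y ∈ box p ℓ, (∑ i, |((y i - p i : ℤ) : ℝ)|) * |ω y μ ν| := by
  have h := abs_sum_mul_le_of_decay (fun w => latticeGreen (w + unitVec e) - latticeGreen w) hC₂ 3 (fun w n hn hw i => hK2 e w n hn hw i)
    (fun y => ω y c₁ c₂) p ℓ (hω1 c₁ c₂) x N hN hx
  refine h.trans ?_
  rw [show (2 : ℝ) ^ 3 * C₂ = 8 * C₂ by norm_num]
  exact mul_le_mul_of_nonneg_left (firstMoment_le_total ω p ℓ c₁ c₂) (by positivity)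

/-- **FAR FIELD OF THE POTENTIAL**: for `x ∉ box p N` (`N ≥ 2ℓ+2`), `|a(x,ν)| ≤ 12·C₂·M₁∕N³`. [folklore] -/
theorem abs_potential_le_far {C₂ : ℝ} (hC₂ : 0 ≤ C₂)
    (hK2 : ∀ (e : Fin 3) (w : Zd 3) (n : ℕ), 2 ≤ n → w ∉ box (0 : Zd 3) ((n : ℤ) - 1) → ∀ i : Fin 3,
      |(latticeGreen (w + unitVec i + unitVec e) - latticeGreen (w + unitVec i)) - (latticeGreen (w + unitVec e) - latticeGreen w)| ≤ C₂ / (n : ℝ) ^ 3)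
    (ω β : Zd 3 → Fin 3 → Fin 3 → ℝ) (a : Zd 3 → Fin 3 → ℝ) (p : Zd 3) (ℓ : ℕ) (hω1 : ∀ μ ν, ∑ y ∈ box p ℓ, ω y μ ν = 0)
    (hβ : ∀ x μ ν, β x μ ν = ∑ y ∈ box p ℓ, latticeGreen (x - y) / 2 * ω y μ ν)
    (ha : ∀ x ν, a x ν = ∑ μ, (β (x - unitVec μ) μ ν - β x μ ν)) (x : Zd 3) (ν : Fin 3) (N : ℕ) (hN : 2 * ℓ + 2 ≤ N)
    (hx : x ∉ box p (N : ℤ)) :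
    |a x ν| ≤ 12 * C₂ / (N : ℝ) ^ 3 * ∑ μ, ∑ ν, ∑ y ∈ box p ℓ, (∑ i, |((y i - p i : ℤ) : ℝ)|) * |ω y μ ν| := by
  obtain ⟨M₁, hM₁⟩ : ∃ M : ℝ, M = ∑ μ, ∑ ν, ∑ y ∈ box p ℓ, (∑ i, |((y i - p i : ℤ) : ℝ)|) * |ω y μ ν| := ⟨_, rfl⟩
  rw [← hM₁]
  rw [potential_eq_conv ω β a p ℓ hβ ha x ν, abs_mul, abs_neg, abs_of_pos (by norm_num : (0 : ℝ) < 1 / 2)]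
  have hx' : ∀ μ : Fin 3, x - unitVec μ ∉ box p ((N : ℤ) - 1) := fun μ => by
    have := sub_unitVec_not_mem_box (r := (N : ℤ) - 1) (by rwa [sub_add_cancel]) μ
    exact this
  have hterm : ∀ μ : Fin 3, |∑ y ∈ box p ℓ, (latticeGreen (x - unitVec μ - y + unitVec μ) - latticeGreen (x - unitVec μ - y)) * ω y μ ν|
      ≤ (8 * C₂ / (N : ℝ) ^ 3) * M₁ := fun μ => by
    rw [hM₁]; exact abs_conv_le_far hC₂ hK2 ω p ℓ hω1 μ μ ν (x - unitVec μ) N hN (hx' μ)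
  calc 1 / 2 * |∑ μ, ∑ y ∈ box p ℓ, (latticeGreen (x - unitVec μ - y + unitVec μ) - latticeGreen (x - unitVec μ - y)) * ω y μ ν|
      ≤ 1 / 2 * ∑ μ : Fin 3, (8 * C₂ / (N : ℝ) ^ 3) * M₁ :=
        mul_le_mul_of_nonneg_left ((Finset.abs_sum_le_sum_abs _ _).trans (Finset.sum_le_sum fun μ _ => hterm μ)) (by norm_num)
    _ = 12 * C₂ / (N : ℝ) ^ 3 * M₁ := by
        simp only [Finset.sum_const, Finset.card_univ, Fintype.card_fin, nsmul_eq_mul]; ring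

/-- **FAR FIELD OF THE CUBE DERIVATIVE**: for `x ∉ box p (N−1)` (`N ≥ 2ℓ+2`), `|γ(x,κ,μ,ν)| ≤ 12·C₂·M₁∕N³`. [folklore] -/
theorem abs_dTwo_le_far {C₂ : ℝ} (hC₂ : 0 ≤ C₂)
    (hK2 : ∀ (e : Fin 3) (w : Zd 3) (n : ℕ), 2 ≤ n → w ∉ box (0 : Zd 3) ((n : ℤ) - 1) → ∀ i : Fin 3,
      |(latticeGreen (w + unitVec i + unitVec e) - latticeGreen (w + unitVec i)) - (latticeGreen (w + unitVec e) - latticeGreen w)| ≤ C₂ / (n : ℝ) ^ 3)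
    (ω β : Zd 3 → Fin 3 → Fin 3 → ℝ) (γ : Zd 3 → Fin 3 → Fin 3 → Fin 3 → ℝ) (p : Zd 3) (ℓ : ℕ) (hω1 : ∀ μ ν, ∑ y ∈ box p ℓ, ω y μ ν = 0)
    (hβ : ∀ x μ ν, β x μ ν = ∑ y ∈ box p ℓ, latticeGreen (x - y) / 2 * ω y μ ν)
    (hγ : ∀ x κ μ ν, γ x κ μ ν = (β (x + unitVec κ) μ ν - β x μ ν) - (β (x + unitVec μ) κ ν - β x κ ν) + (β (x + unitVec ν) κ μ - β x κ μ))
    (x : Zd 3) (κ μ ν : Fin 3) (N : ℕ) (hN : 2 * ℓ + 2 ≤ N) (hx : x ∉ box p ((N : ℤ) - 1)) :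
    |γ x κ μ ν| ≤ 12 * C₂ / (N : ℝ) ^ 3 * ∑ μ, ∑ ν, ∑ y ∈ box p ℓ, (∑ i, |((y i - p i : ℤ) : ℝ)|) * |ω y μ ν| := by
  obtain ⟨M₁, hM₁⟩ : ∃ M : ℝ, M = ∑ μ, ∑ ν, ∑ y ∈ box p ℓ, (∑ i, |((y i - p i : ℤ) : ℝ)|) * |ω y μ ν| := ⟨_, rfl⟩
  rw [← hM₁]
  rw [dTwo_eq_conv ω β γ p ℓ hβ hγ x κ μ ν]
  have h1 := abs_conv_le_far hC₂ hK2 ω p ℓ hω1 κ μ ν x N hN hx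
  have h2 := abs_conv_le_far hC₂ hK2 ω p ℓ hω1 μ κ ν x N hN hx
  have h3 := abs_conv_le_far hC₂ hK2 ω p ℓ hω1 ν κ μ x N hN hx
  rw [← hM₁] at h1 h2 h3
  have hQ : 12 * C₂ / (N : ℝ) ^ 3 * M₁ = (3 / 2) * ((8 * C₂ / (N : ℝ) ^ 3) * M₁) := by ring
  rw [hQ]
  rw [abs_le] at h1 h2 h3 ⊢
  constructor <;> linarith [h1.1, h1.2, h2.1, h2.2, h3.1, h3.2]

/-! ## §3 The shell -/

/-- ★★ **THE SHELL PRICED**: with `2ℓ + 4 ≤ R` and `R − 1 ≤ S + 1`, FILE 1's shell sum is at most `540·#box p (S+1)·C₂·M₁∕(R−2)³`. [folklore] -/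
theorem shell_le {C₂ : ℝ} (hC₂ : 0 ≤ C₂)
    (hK2 : ∀ (e : Fin 3) (w : Zd 3) (n : ℕ), 2 ≤ n → w ∉ box (0 : Zd 3) ((n : ℤ) - 1) → ∀ i : Fin 3,
      |(latticeGreen (w + unitVec i + unitVec e) - latticeGreen (w + unitVec i)) - (latticeGreen (w + unitVec e) - latticeGreen w)| ≤ C₂ / (n : ℝ) ^ 3)
    (ω β : Zd 3 → Fin 3 → Fin 3 → ℝ) (a : Zd 3 → Fin 3 → ℝ) (γ : Zd 3 → Fin 3 → Fin 3 → Fin 3 → ℝ) (p : Zd 3) (ℓ R : ℕ) (S : ℤ)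
    (hω1 : ∀ μ ν, ∑ y ∈ box p ℓ, ω y μ ν = 0)
    (hβ : ∀ x μ ν, β x μ ν = ∑ y ∈ box p ℓ, latticeGreen (x - y) / 2 * ω y μ ν)
    (ha : ∀ x ν, a x ν = ∑ μ, (β (x - unitVec μ) μ ν - β x μ ν))
    (hγ : ∀ x κ μ ν, γ x κ μ ν = (β (x + unitVec κ) μ ν - β x μ ν) - (β (x + unitVec μ) κ ν - β x κ ν) + (β (x + unitVec ν) κ μ - β x κ μ))
    (hR : 2 * ℓ + 4 ≤ R) :
    ∑ y ∈ box p (S + 1) \ box p ((R : ℤ) - 1), ∑ μ, ∑ ν, (|a (y + unitVec μ) ν| + |a (y + unitVec ν) μ| + ∑ κ, |γ (y - unitVec κ) κ μ ν|)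
      ≤ 540 * ((box p (S + 1)).card : ℝ) * C₂ / ((R - 2 : ℕ) : ℝ) ^ 3
          * ∑ μ, ∑ ν, ∑ y ∈ box p ℓ, (∑ i, |((y i - p i : ℤ) : ℝ)|) * |ω y μ ν| := by
  obtain ⟨M₁, hM₁⟩ : ∃ M : ℝ, M = ∑ μ, ∑ ν, ∑ y ∈ box p ℓ, (∑ i, |((y i - p i : ℤ) : ℝ)|) * |ω y μ ν| := ⟨_, rfl⟩
  rw [← hM₁]
  have hM₁0 : 0 ≤ M₁ := by
    rw [hM₁]; exact Finset.sum_nonneg fun _ _ => Finset.sum_nonneg fun _ _ => Finset.sum_nonneg fun _ _ => by positivity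
  have hN : 2 * ℓ + 2 ≤ R - 2 := by omega
  have hNR : ((R - 2 : ℕ) : ℤ) = (R : ℤ) - 2 := by omega
  have hNpos : (0 : ℝ) < ((R - 2 : ℕ) : ℝ) := by exact_mod_cast (show 0 < R - 2 by omega)
  obtain ⟨P, hP⟩ : ∃ P : ℝ, P = 12 * C₂ / ((R - 2 : ℕ) : ℝ) ^ 3 * M₁ := ⟨_, rfl⟩
  have hP0 : 0 ≤ P := by rw [hP]; exact mul_nonneg (div_nonneg (by positivity) (by positivity)) hM₁0
  -- per-site bound on the annulus
  have hsite : ∀ y ∈ box p (S + 1) \ box p ((R : ℤ) - 1),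
      ∑ μ, ∑ ν, (|a (y + unitVec μ) ν| + |a (y + unitVec ν) μ| + ∑ κ, |γ (y - unitVec κ) κ μ ν|) ≤ 45 * P := by
    intro y hy
    have hy' : y ∉ box p ((R : ℤ) - 1) := (Finset.mem_sdiff.1 hy).2
    -- shifted points stay outside `box p (R−2)` resp. `box p (R−3)`
    have hyN1 : y ∉ box p (((R - 2 : ℕ) : ℤ) + 1) := by rwa [hNR, show (R : ℤ) - 2 + 1 = (R : ℤ) - 1 by ring]
    have hplus : ∀ μ : Fin 3, y + unitVec μ ∉ box p ((R - 2 : ℕ) : ℤ) := fun μ => add_unitVec_not_mem_box hyN1 μ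
    have hminus : ∀ κ : Fin 3, y - unitVec κ ∉ box p (((R - 2 : ℕ) : ℤ) - 1) := fun κ => by
      have h1 : y - unitVec κ ∉ box p ((R - 2 : ℕ) : ℤ) := sub_unitVec_not_mem_box hyN1 κ
      exact fun h => h1 (box_mono p (by linarith) h)
    have ha_le : ∀ μ ν : Fin 3, |a (y + unitVec μ) ν| ≤ P := fun μ ν => by
      rw [hP, hM₁]; exact abs_potential_le_far hC₂ hK2 ω β a p ℓ hω1 hβ ha (y + unitVec μ) ν (R - 2) hN (hplus μ)
    have hγ_le : ∀ κ μ ν : Fin 3, |γ (y - unitVec κ) κ μ ν| ≤ P := fun κ μ ν => by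
      rw [hP, hM₁]; exact abs_dTwo_le_far hC₂ hK2 ω β γ p ℓ hω1 hβ hγ (y - unitVec κ) κ μ ν (R - 2) hN (hminus κ)
    calc ∑ μ, ∑ ν, (|a (y + unitVec μ) ν| + |a (y + unitVec ν) μ| + ∑ κ, |γ (y - unitVec κ) κ μ ν|)
        ≤ ∑ _μ : Fin 3, ∑ _ν : Fin 3, (P + P + ∑ _κ : Fin 3, P) :=
          Finset.sum_le_sum fun μ _ => Finset.sum_le_sum fun ν _ =>
            add_le_add (add_le_add (ha_le μ ν) (ha_le ν μ)) (Finset.sum_le_sum fun κ _ => hγ_le κ μ ν)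
      _ = 45 * P := by simp only [Finset.sum_const, Finset.card_univ, Fintype.card_fin, nsmul_eq_mul]; ring
  -- sum over the annulus ⊆ box p (S+1)
  calc ∑ y ∈ box p (S + 1) \ box p ((R : ℤ) - 1), ∑ μ, ∑ ν, (|a (y + unitVec μ) ν| + |a (y + unitVec ν) μ| + ∑ κ, |γ (y - unitVec κ) κ μ ν|)
      ≤ ∑ _y ∈ box p (S + 1) \ box p ((R : ℤ) - 1), 45 * P := Finset.sum_le_sum hsite
    _ = (((box p (S + 1) \ box p ((R : ℤ) - 1)).card : ℕ) : ℝ) * (45 * P) := by rw [Finset.sum_const, nsmul_eq_mul]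
    _ ≤ ((box p (S + 1)).card : ℝ) * (45 * P) := by
        refine mul_le_mul_of_nonneg_right ?_ (mul_nonneg (by norm_num) hP0)
        exact_mod_cast Finset.card_le_card Finset.sdiff_subset
    _ = 540 * ((box p (S + 1)).card : ℝ) * C₂ / ((R - 2 : ℕ) : ℝ) ^ 3 * M₁ := by rw [hP]; ring

/-- ★★ **THE SHELL AT `S = 2R`, `R ≥ 12`**: `SHELL ≤ 72000·C₂·M₁` (`#box p (2R+1) = (4R+3)³ ≤ (5.1(R−2))³`). [folklore] -/
theorem shell_le_of_twelve_le {C₂ : ℝ} (hC₂ : 0 ≤ C₂)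
    (hK2 : ∀ (e : Fin 3) (w : Zd 3) (n : ℕ), 2 ≤ n → w ∉ box (0 : Zd 3) ((n : ℤ) - 1) → ∀ i : Fin 3,
      |(latticeGreen (w + unitVec i + unitVec e) - latticeGreen (w + unitVec i)) - (latticeGreen (w + unitVec e) - latticeGreen w)| ≤ C₂ / (n : ℝ) ^ 3)
    (ω β : Zd 3 → Fin 3 → Fin 3 → ℝ) (a : Zd 3 → Fin 3 → ℝ) (γ : Zd 3 → Fin 3 → Fin 3 → Fin 3 → ℝ) (p : Zd 3) (ℓ R : ℕ)
    (hω1 : ∀ μ ν, ∑ y ∈ box p ℓ, ω y μ ν = 0)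
    (hβ : ∀ x μ ν, β x μ ν = ∑ y ∈ box p ℓ, latticeGreen (x - y) / 2 * ω y μ ν)
    (ha : ∀ x ν, a x ν = ∑ μ, (β (x - unitVec μ) μ ν - β x μ ν))
    (hγ : ∀ x κ μ ν, γ x κ μ ν = (β (x + unitVec κ) μ ν - β x μ ν) - (β (x + unitVec μ) κ ν - β x κ ν) + (β (x + unitVec ν) κ μ - β x κ μ))
    (hR : 2 * ℓ + 4 ≤ R) (hR12 : 12 ≤ R) :
    ∑ y ∈ box p (2 * (R : ℤ) + 1) \ box p ((R : ℤ) - 1), ∑ μ, ∑ ν, (|a (y + unitVec μ) ν| + |a (y + unitVec ν) μ| + ∑ κ, |γ (y - unitVec κ) κ μ ν|)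
      ≤ 72000 * C₂ * ∑ μ, ∑ ν, ∑ y ∈ box p ℓ, (∑ i, |((y i - p i : ℤ) : ℝ)|) * |ω y μ ν| := by
  obtain ⟨M₁, hM₁⟩ : ∃ M : ℝ, M = ∑ μ, ∑ ν, ∑ y ∈ box p ℓ, (∑ i, |((y i - p i : ℤ) : ℝ)|) * |ω y μ ν| := ⟨_, rfl⟩
  rw [← hM₁]
  have hM₁0 : 0 ≤ M₁ := by
    rw [hM₁]; exact Finset.sum_nonneg fun _ _ => Finset.sum_nonneg fun _ _ => Finset.sum_nonneg fun _ _ => by positivity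
  have h := shell_le hC₂ hK2 ω β a γ p ℓ R (2 * (R : ℤ)) hω1 hβ ha hγ hR
  rw [← hM₁] at h
  refine h.trans ?_
  have hcard : ((box p (2 * (R : ℤ) + 1)).card : ℝ) = (4 * (R : ℝ) + 3) ^ 3 := by
    rw [card_box p (by positivity)]; push_cast; ring
  have hR2 : ((R - 2 : ℕ) : ℝ) = (R : ℝ) - 2 := by
    rw [Nat.cast_sub (by omega)]; norm_num
  rw [hcard, hR2]
  have hR' : (12 : ℝ) ≤ R := by exact_mod_cast hR12
  have hpos : (0 : ℝ) < ((R : ℝ) - 2) ^ 3 := by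
    have : (0 : ℝ) < (R : ℝ) - 2 := by linarith
    positivity
  -- `540 (4R+3)³ ≤ 72000 (R−2)³` for `R ≥ 12`
  have hkey : 540 * (4 * (R : ℝ) + 3) ^ 3 ≤ 72000 * ((R : ℝ) - 2) ^ 3 := by
    have h51 : 4 * (R : ℝ) + 3 ≤ (51 / 10) * ((R : ℝ) - 2) := by linarith
    have h0 : (0 : ℝ) ≤ 4 * (R : ℝ) + 3 := by positivity
    calc 540 * (4 * (R : ℝ) + 3) ^ 3 ≤ 540 * ((51 / 10) * ((R : ℝ) - 2)) ^ 3 := by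
          exact mul_le_mul_of_nonneg_left (pow_le_pow_left₀ h0 h51 3) (by norm_num)
      _ = (540 * (51 / 10) ^ 3) * ((R : ℝ) - 2) ^ 3 := by ring
      _ ≤ 72000 * ((R : ℝ) - 2) ^ 3 := by
          refine mul_le_mul_of_nonneg_right (by norm_num) hpos.le
  have hfrac : 540 * (4 * (R : ℝ) + 3) ^ 3 / ((R : ℝ) - 2) ^ 3 ≤ 72000 := by
    rw [div_le_iff₀ hpos]; exact hkey
  calc 540 * (4 * (R : ℝ) + 3) ^ 3 * C₂ / ((R : ℝ) - 2) ^ 3 * M₁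
      = (540 * (4 * (R : ℝ) + 3) ^ 3 / ((R : ℝ) - 2) ^ 3) * (C₂ * M₁) := by ring
    _ ≤ 72000 * (C₂ * M₁) := mul_le_mul_of_nonneg_right hfrac (mul_nonneg hC₂ hM₁0)
    _ = 72000 * C₂ * M₁ := by ring

/-! ## §4 The bulk mass and the near ℓ¹ mass -/

/-- One component's mass is at most the total mass. [folklore] -/
theorem mass_le_total (ω : Zd 3 → Fin 3 → Fin 3 → ℝ) (p : Zd 3) (ℓ : ℕ) (c₁ c₂ : Fin 3) :
    ∑ y ∈ box p ℓ, |ω y c₁ c₂| ≤ ∑ μ, ∑ ν, ∑ y ∈ box p ℓ, |ω y μ ν| := by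
  have h1 : ∑ y ∈ box p ℓ, |ω y c₁ c₂| ≤ ∑ ν, ∑ y ∈ box p ℓ, |ω y c₁ ν| :=
    Finset.single_le_sum (f := fun ν => ∑ y ∈ box p ℓ, |ω y c₁ ν|) (fun ν _ => Finset.sum_nonneg fun y _ => abs_nonneg _) (Finset.mem_univ c₂)
  refine h1.trans ?_
  exact Finset.single_le_sum (f := fun μ => ∑ ν, ∑ y ∈ box p ℓ, |ω y μ ν|)
    (fun μ _ => Finset.sum_nonneg fun ν _ => Finset.sum_nonneg fun y _ => abs_nonneg _) (Finset.mem_univ c₁)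

/-- The box `ℓ¹` mass of one first-difference convolution ((Z-c) by name): `Σ_{x ∈ box p S}|(K_e ∗ ω_c)(x)| ≤ (|K_e 0| + 26C₁(S+ℓ))·M₀`. [folklore] -/
theorem sum_box_abs_conv_le {C₁ : ℝ} (hC₁ : 0 ≤ C₁)
    (hK1 : ∀ (e : Fin 3) (w : Zd 3) (n : ℕ), 1 ≤ n → w ∉ box (0 : Zd 3) ((n : ℤ) - 1) →
      |latticeGreen (w + unitVec e) - latticeGreen w| ≤ C₁ / (n : ℝ) ^ 2)
    (ω : Zd 3 → Fin 3 → Fin 3 → ℝ) (p : Zd 3) (ℓ S : ℕ) (e c₁ c₂ : Fin 3) :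
    ∑ x ∈ box p S, |∑ y ∈ box p ℓ, (latticeGreen (x - y + unitVec e) - latticeGreen (x - y)) * ω y c₁ c₂|
      ≤ (|latticeGreen (unitVec e) - latticeGreen (0 : Zd 3)| + 26 * C₁ * ((S : ℝ) + ℓ)) * ∑ μ, ∑ ν, ∑ y ∈ box p ℓ, |ω y μ ν| := by
  have h := sum_box_abs_sum_mul_le (fun w => latticeGreen (w + unitVec e) - latticeGreen w) hC₁ (fun w n hn hw => hK1 e w n hn hw)
    (fun y => ω y c₁ c₂) p ℓ S
  rw [zero_add] at h
  exact h.trans (mul_le_mul_of_nonneg_left (mass_le_total ω p ℓ c₁ c₂) (by positivity))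

/-- ★ **THE BULK MASS**: `Σ_{box p S} Σ_{κμν}|γ| ≤ (81∕2)·(Σ_e|K_e 0| + 26·C₁·(S+ℓ))·M₀`. [folklore] -/
theorem bulk_mass_le {C₁ : ℝ} (hC₁ : 0 ≤ C₁)
    (hK1 : ∀ (e : Fin 3) (w : Zd 3) (n : ℕ), 1 ≤ n → w ∉ box (0 : Zd 3) ((n : ℤ) - 1) →
      |latticeGreen (w + unitVec e) - latticeGreen w| ≤ C₁ / (n : ℝ) ^ 2)
    (ω β : Zd 3 → Fin 3 → Fin 3 → ℝ) (γ : Zd 3 → Fin 3 → Fin 3 → Fin 3 → ℝ) (p : Zd 3) (ℓ S : ℕ)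
    (hβ : ∀ x μ ν, β x μ ν = ∑ y ∈ box p ℓ, latticeGreen (x - y) / 2 * ω y μ ν)
    (hγ : ∀ x κ μ ν, γ x κ μ ν = (β (x + unitVec κ) μ ν - β x μ ν) - (β (x + unitVec μ) κ ν - β x κ ν) + (β (x + unitVec ν) κ μ - β x κ μ)) :
    ∑ y ∈ box p S, ∑ κ, ∑ μ, ∑ ν, |γ y κ μ ν|
      ≤ (81 / 2) * ((∑ e : Fin 3, |latticeGreen (unitVec e) - latticeGreen (0 : Zd 3)|) + 26 * C₁ * ((S : ℝ) + ℓ))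
          * ∑ μ, ∑ ν, ∑ y ∈ box p ℓ, |ω y μ ν| := by
  obtain ⟨M₀, hM₀⟩ : ∃ M : ℝ, M = ∑ μ, ∑ ν, ∑ y ∈ box p ℓ, |ω y μ ν| := ⟨_, rfl⟩
  have hM₀0 : 0 ≤ M₀ := by
    rw [hM₀]; exact Finset.sum_nonneg fun _ _ => Finset.sum_nonneg fun _ _ => Finset.sum_nonneg fun _ _ => abs_nonneg _
  obtain ⟨K₀, hK₀⟩ : ∃ K : ℝ, K = ∑ e : Fin 3, |latticeGreen (unitVec e) - latticeGreen (0 : Zd 3)| := ⟨_, rfl⟩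
  rw [← hM₀, ← hK₀]
  have hK₀e : ∀ e : Fin 3, |latticeGreen (unitVec e) - latticeGreen (0 : Zd 3)| ≤ K₀ := fun e => by
    rw [hK₀]
    exact Finset.single_le_sum (f := fun e => |latticeGreen (unitVec e) - latticeGreen (0 : Zd 3)|) (fun _ _ => abs_nonneg _) (Finset.mem_univ e)
  set U : Fin 3 → Zd 3 → Fin 3 → Fin 3 → ℝ :=
    fun e x c₁ c₂ => |∑ y ∈ box p ℓ, (latticeGreen (x - y + unitVec e) - latticeGreen (x - y)) * ω y c₁ c₂| with hU
  -- each `U`-box-sum is bounded by the uniform constant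
  have hUsum : ∀ e c₁ c₂, ∑ x ∈ box p S, U e x c₁ c₂ ≤ (K₀ + 26 * C₁ * ((S : ℝ) + ℓ)) * M₀ := by
    intro e c₁ c₂
    have h := sum_box_abs_conv_le hC₁ hK1 ω p ℓ S e c₁ c₂
    rw [← hM₀] at h
    refine h.trans ?_
    exact mul_le_mul_of_nonneg_right (by linarith [hK₀e e]) hM₀0
  -- pointwise: `|γ| ≤ ½ (U κ μν + U μ κν + U ν κμ)`
  have hpt : ∀ x κ μ ν, |γ x κ μ ν| ≤ (1 / 2) * U κ x μ ν + (1 / 2) * U μ x κ ν + (1 / 2) * U ν x κ μ := by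
    intro x κ μ ν
    rw [dTwo_eq_conv ω β γ p ℓ hβ hγ x κ μ ν]
    have hA := abs_add_le ((1 / 2 : ℝ) * ∑ y ∈ box p ℓ, (latticeGreen (x - y + unitVec κ) - latticeGreen (x - y)) * ω y μ ν
        - 1 / 2 * ∑ y ∈ box p ℓ, (latticeGreen (x - y + unitVec μ) - latticeGreen (x - y)) * ω y κ ν)
      (1 / 2 * ∑ y ∈ box p ℓ, (latticeGreen (x - y + unitVec ν) - latticeGreen (x - y)) * ω y κ μ)
    have hB := abs_sub ((1 / 2 : ℝ) * ∑ y ∈ box p ℓ, (latticeGreen (x - y + unitVec κ) - latticeGreen (x - y)) * ω y μ ν)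
      (1 / 2 * ∑ y ∈ box p ℓ, (latticeGreen (x - y + unitVec μ) - latticeGreen (x - y)) * ω y κ ν)
    simp only [abs_mul, abs_of_pos (by norm_num : (0 : ℝ) < 1 / 2)] at hA hB
    simp only [hU]
    linarith
  -- commute the site sum inside
  have comm4 : ∀ (g : Zd 3 → Fin 3 → Fin 3 → Fin 3 → ℝ) (T : Finset (Zd 3)),
      ∑ x ∈ T, ∑ κ, ∑ μ, ∑ ν, g x κ μ ν = ∑ κ, ∑ μ, ∑ ν, ∑ x ∈ T, g x κ μ ν := by
    intro g T
    rw [Finset.sum_comm]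
    refine Finset.sum_congr rfl fun κ _ => ?_
    rw [Finset.sum_comm]
    exact Finset.sum_congr rfl fun μ _ => Finset.sum_comm
  have h27 : ∀ (g : Fin 3 → Zd 3 → Fin 3 → Fin 3 → ℝ) (σ₁ σ₂ σ₃ : Fin 3 → Fin 3 → Fin 3 → Fin 3),
      (∀ e c₁ c₂, ∑ x ∈ box p S, g e x c₁ c₂ ≤ (K₀ + 26 * C₁ * ((S : ℝ) + ℓ)) * M₀) →
      ∑ x ∈ box p (S : ℤ), ∑ κ, ∑ μ, ∑ ν, g (σ₁ κ μ ν) x (σ₂ κ μ ν) (σ₃ κ μ ν) ≤ 27 * ((K₀ + 26 * C₁ * ((S : ℝ) + ℓ)) * M₀) := by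
    intro g σ₁ σ₂ σ₃ hg
    rw [comm4 (fun x κ μ ν => g (σ₁ κ μ ν) x (σ₂ κ μ ν) (σ₃ κ μ ν)) (box p (S : ℤ))]
    calc ∑ κ : Fin 3, ∑ μ : Fin 3, ∑ ν : Fin 3, ∑ x ∈ box p (S : ℤ), g (σ₁ κ μ ν) x (σ₂ κ μ ν) (σ₃ κ μ ν)
        ≤ ∑ _κ : Fin 3, ∑ _μ : Fin 3, ∑ _ν : Fin 3, (K₀ + 26 * C₁ * ((S : ℝ) + ℓ)) * M₀ :=
          Finset.sum_le_sum fun κ _ => Finset.sum_le_sum fun μ _ => Finset.sum_le_sum fun ν _ => hg _ _ _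
      _ = 27 * ((K₀ + 26 * C₁ * ((S : ℝ) + ℓ)) * M₀) := by
          simp only [Finset.sum_const, Finset.card_univ, Fintype.card_fin, nsmul_eq_mul]; ring
  have h1 := h27 U (fun κ _ _ => κ) (fun _ μ _ => μ) (fun _ _ ν => ν) hUsum
  have h2 := h27 U (fun _ μ _ => μ) (fun κ _ _ => κ) (fun _ _ ν => ν) hUsum
  have h3 := h27 U (fun _ _ ν => ν) (fun κ _ _ => κ) (fun _ μ _ => μ) hUsum
  calc ∑ y ∈ box p S, ∑ κ, ∑ μ, ∑ ν, |γ y κ μ ν|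
      ≤ ∑ y ∈ box p S, ∑ κ, ∑ μ, ∑ ν, ((1 / 2) * U κ y μ ν + (1 / 2) * U μ y κ ν + (1 / 2) * U ν y κ μ) :=
        Finset.sum_le_sum fun y _ => Finset.sum_le_sum fun κ _ => Finset.sum_le_sum fun μ _ => Finset.sum_le_sum fun ν _ => hpt y κ μ ν
    _ = (1 / 2) * (∑ y ∈ box p S, ∑ κ, ∑ μ, ∑ ν, U κ y μ ν) + (1 / 2) * (∑ y ∈ box p S, ∑ κ, ∑ μ, ∑ ν, U μ y κ ν)
          + (1 / 2) * (∑ y ∈ box p S, ∑ κ, ∑ μ, ∑ ν, U ν y κ μ) := by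
        simp only [Finset.sum_add_distrib, Finset.mul_sum]
    _ ≤ (1 / 2) * (27 * ((K₀ + 26 * C₁ * ((S : ℝ) + ℓ)) * M₀)) + (1 / 2) * (27 * ((K₀ + 26 * C₁ * ((S : ℝ) + ℓ)) * M₀))
          + (1 / 2) * (27 * ((K₀ + 26 * C₁ * ((S : ℝ) + ℓ)) * M₀)) := by linarith
    _ = (81 / 2) * (K₀ + 26 * C₁ * ((S : ℝ) + ℓ)) * M₀ := by ring

/-- ★ **THE NEAR ℓ¹ MASS OF THE POTENTIAL**: `Σ_{box p S} Σ_ν |a| ≤ (9∕2)·(Σ_e|K_e 0| + 26·C₁·(S+1+ℓ))·M₀`. [folklore] -/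
theorem near_mass_le {C₁ : ℝ} (hC₁ : 0 ≤ C₁)
    (hK1 : ∀ (e : Fin 3) (w : Zd 3) (n : ℕ), 1 ≤ n → w ∉ box (0 : Zd 3) ((n : ℤ) - 1) →
      |latticeGreen (w + unitVec e) - latticeGreen w| ≤ C₁ / (n : ℝ) ^ 2)
    (ω β : Zd 3 → Fin 3 → Fin 3 → ℝ) (a : Zd 3 → Fin 3 → ℝ) (p : Zd 3) (ℓ S : ℕ)
    (hβ : ∀ x μ ν, β x μ ν = ∑ y ∈ box p ℓ, latticeGreen (x - y) / 2 * ω y μ ν)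
    (ha : ∀ x ν, a x ν = ∑ μ, (β (x - unitVec μ) μ ν - β x μ ν)) :
    ∑ x ∈ box p S, ∑ ν, |a x ν|
      ≤ (9 / 2) * ((∑ e : Fin 3, |latticeGreen (unitVec e) - latticeGreen (0 : Zd 3)|) + 26 * C₁ * ((S : ℝ) + 1 + ℓ))
          * ∑ μ, ∑ ν, ∑ y ∈ box p ℓ, |ω y μ ν| := by
  obtain ⟨M₀, hM₀⟩ : ∃ M : ℝ, M = ∑ μ, ∑ ν, ∑ y ∈ box p ℓ, |ω y μ ν| := ⟨_, rfl⟩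
  have hM₀0 : 0 ≤ M₀ := by
    rw [hM₀]; exact Finset.sum_nonneg fun _ _ => Finset.sum_nonneg fun _ _ => Finset.sum_nonneg fun _ _ => abs_nonneg _
  obtain ⟨K₀, hK₀⟩ : ∃ K : ℝ, K = ∑ e : Fin 3, |latticeGreen (unitVec e) - latticeGreen (0 : Zd 3)| := ⟨_, rfl⟩
  rw [← hM₀, ← hK₀]
  have hK₀e : ∀ e : Fin 3, |latticeGreen (unitVec e) - latticeGreen (0 : Zd 3)| ≤ K₀ := fun e => by
    rw [hK₀]
    exact Finset.single_le_sum (f := fun e => |latticeGreen (unitVec e) - latticeGreen (0 : Zd 3)|) (fun _ _ => abs_nonneg _) (Finset.mem_univ e)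
  set U : Fin 3 → Zd 3 → Fin 3 → Fin 3 → ℝ :=
    fun e x c₁ c₂ => |∑ y ∈ box p ℓ, (latticeGreen (x - y + unitVec e) - latticeGreen (x - y)) * ω y c₁ c₂| with hU
  have hpt : ∀ x ν, |a x ν| ≤ (1 / 2) * ∑ μ, U μ (x - unitVec μ) μ ν := by
    intro x ν
    rw [potential_eq_conv ω β a p ℓ hβ ha x ν, abs_mul, abs_neg, abs_of_pos (by norm_num : (0 : ℝ) < 1 / 2)]
    exact mul_le_mul_of_nonneg_left (Finset.abs_sum_le_sum_abs _ _) (by norm_num)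
  -- shifted boxes: `x ∈ box p S ⇒ x − e_μ ∈ box p (S+1)`
  have hshift : ∀ μ ν, ∑ x ∈ box p (S : ℤ), U μ (x - unitVec μ) μ ν ≤ ∑ z ∈ box p ((S + 1 : ℕ) : ℤ), U μ z μ ν := by
    intro μ ν
    have hinj : Set.InjOn (fun x : Zd 3 => x - unitVec μ) ↑(box p (S : ℤ)) := fun x _ x' _ h => sub_left_injective h
    have himg : ∑ z ∈ (box p (S : ℤ)).image (fun x => x - unitVec μ), U μ z μ ν = ∑ x ∈ box p (S : ℤ), U μ (x - unitVec μ) μ ν :=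
      Finset.sum_image hinj
    rw [← himg]
    refine Finset.sum_le_sum_of_subset_of_nonneg ?_ fun z _ _ => abs_nonneg _
    intro z hz
    obtain ⟨x, hx, rfl⟩ := Finset.mem_image.1 hz
    push_cast
    exact sub_unitVec_mem_box hx μ
  have hUsum : ∀ e c₁ c₂, ∑ x ∈ box p ((S + 1 : ℕ) : ℤ), U e x c₁ c₂ ≤ (K₀ + 26 * C₁ * ((S : ℝ) + 1 + ℓ)) * M₀ := by
    intro e c₁ c₂
    have h := sum_box_abs_conv_le hC₁ hK1 ω p ℓ (S + 1) e c₁ c₂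
    rw [← hM₀] at h
    push_cast at h
    refine h.trans ?_
    exact mul_le_mul_of_nonneg_right (by linarith [hK₀e e]) hM₀0
  have hcomm : ∑ x ∈ box p (S : ℤ), ∑ ν, (1 / 2) * ∑ μ, U μ (x - unitVec μ) μ ν
      = (1 / 2) * ∑ ν, ∑ μ, ∑ x ∈ box p (S : ℤ), U μ (x - unitVec μ) μ ν := by
    rw [Finset.sum_comm]
    simp only [Finset.mul_sum]
    exact Finset.sum_congr rfl fun ν _ => Finset.sum_comm
  calc ∑ x ∈ box p S, ∑ ν, |a x ν| ≤ ∑ x ∈ box p (S : ℤ), ∑ ν, (1 / 2) * ∑ μ, U μ (x - unitVec μ) μ ν :=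
        Finset.sum_le_sum fun x _ => Finset.sum_le_sum fun ν _ => hpt x ν
    _ = (1 / 2) * ∑ ν, ∑ μ, ∑ x ∈ box p (S : ℤ), U μ (x - unitVec μ) μ ν := hcomm
    _ ≤ (1 / 2) * ∑ _ν : Fin 3, ∑ _μ : Fin 3, (K₀ + 26 * C₁ * ((S : ℝ) + 1 + ℓ)) * M₀ := by
        gcongr with ν _ μ _
        exact (hshift μ ν).trans (hUsum μ μ ν)
    _ = (9 / 2) * (K₀ + 26 * C₁ * ((S : ℝ) + 1 + ℓ)) * M₀ := by
        simp only [Finset.sum_const, Finset.card_univ, Fintype.card_fin, nsmul_eq_mul]; ring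

end Summit.QuantumFields.YangMills.Theorems.CovariantDischargeGreenPotentialShell

end
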